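import Summits.QuantumFields.YangMills.Theorems.IR.AfPincerUcSharpOnset

/-!
# Crux `IR` (stmt-QuantumFields-19354), slot `af-pincer-Uc` sharp re-cut (skeleton 28967a1bf60ad397, owner R104):
# the NT calibration `LowerBounds` is LOAD-BEARING for `stub_onsetSharpSC` (kernel grade)

Refuter lane B `ym-cdisprove-19354-afonset` (gen 2), strategy B «decide the super-polynomial regime: build the kill-world (format Uc
failing at every calibrated mesh along `β → ∞`) or show it contradicts `LowerBounds`».  Negative-lane module for item
`stmt-QuantumFields-19354` (`--supports`; it closes nothing and asserts no Theses statement).  Companion: `OnsetSharpSCKillWorld.lean`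
(the kill-world `KSMInfSharp`, `¬ I♯_SC ↔ KSMInfSharp`, maximal-tolerance reductions).

WHAT IS PROVED (sorry-free; axioms `propext`, `Classical.choice`, `Quot.sound`):

* §1 `typShellCondUKPc_mono` — format Uc is MONOTONE in the mixing budget `ε` and the rarity budget `δ ≥ 0` (clause (i) is `|…| ≤ ε`,
  clauses (ii)/(iii) are `≤ δ ^ #F`); `shellCount_pos`.
* §2 `floorSU2_uc` — the tree's `SU(2)` fixed-mesh onset floor (`FixedMesh.typOnsetFloor_SU2`) in Uc currency, UNIFORM over all budgets
  `0 ≤ ε ≤ 1/16`, `0 ≤ δ ≤ deltaCap n` (by §1 it suffices to run the floor once, at the caps).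
* §3 `exists_slow_unit_map` — DIAGONALISATION (pure real analysis): if for every `n` and every mesh bound `B` some property `Fail n β b` holds
  for all large `β` at every mesh `1 ≤ b ≤ B`, then ONE positive unit map `a → 0` makes, for every `n` and every calibration factor `T`, for
  all large `β`, EVERY mesh `b ≥ 1` with `a β · b < T` satisfy `Fail n β b` (a step function `a = 1/(M(β)+1)` slower than every floor).
* §4 **`onsetSharpUKPcSC_false_without_lowerBounds : SimplyConnectedSpace SU(2) → ¬ OnsetSharpUKPcSCWithoutLB`** — the registered stub
  `stub_onsetSharpSC : AfPincerUc.SharpOnset.OnsetSharpUKPcSC` with its hypothesis `LowerBounds G r a` DELETED is FALSE: witness `G = SU(2)`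
  (`isCompactSimpleLieGroup_specialUnitaryGroup`; simple connectedness is the tree's sorry-free
  `Summit.QuantumFields.YangMills.Theorems.BrascampLiebVacuumSC.Negative.simplyConnectedSpace_su2`, carried here as the hypothesis `hSC`
  only to keep this module outside the `ConvexGribovBody` theses cone — the same convention as
  `Theorems/SusceptibilityToPoincare/Negative/TwistSectorSimplyConnected.lean`), `r` = fundamental, `a` = the slow unit map of §3 over the
  floors of §2 — every calibrated mesh `b < T / a(β)` lies below the fixed-mesh floor, so format Uc fails there for all large `β`, at every
  admissible `(n, ε)` and the budget `δ = deltaCap n`.  READING: strategy B's kill-world «format Uc fails at every NT-calibrated mesh along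
  `β → ∞`, at every admissible `(n, ε)`» EXISTS in the kernel as soon as the unit map is not tied to the theory; `LowerBounds`
  (non-triviality in units `a`, which pins `1/a` to the physical correlation scale) is exactly the hypothesis that excludes it.  Any proof of
  `stub_onsetSharpSC` must therefore USE `LowerBounds` quantitatively (an upper bound on the onset scale in units `a`), not merely as a
  non-vacuity guard; `onsetSharpUKPcSC_of_withoutLB` records that the deleted form was the stronger statement.

HONEST FRAMING: load-bearing analysis for ONE open stub of a CONDITIONAL reduction chain (Track A 0/28 UV); nothing here proves or refutes
weak-coupling mixing or a mass gap; not Clay.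
-/

set_option autoImplicit false

noncomputable section

open Filter Topology MeasureTheory
open Literature.MathematicalPhysics.QuantumFieldTheory Literature.MathematicalPhysics.QuantumLattice
open Summit.QuantumFields.YangMills.Cruxes.OSLegsFromFemtoAndGap.DlrCollarTransfer (LowerBounds)
open Summit.QuantumFields.YangMills.Cruxes.IR.ShellTempered (windowCellsPlus)
open Summit.QuantumFields.YangMills.Cruxes.IR.FixedMesh (ClauseI typOnsetFloor_SU2 fundRepSU2 sixteen_mul_eps_lt_one)

namespace Summit.QuantumFields.YangMills.Cruxes.IR.AfPincerUc.SharpOnset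

open Summit.QuantumFields.YangMills.Cruxes.IR.AfPincerUc

/-! ## §1 Monotonicity of format Uc in the budgets -/
section Mono

variable {G : Type} [Group G] [TopologicalSpace G] [IsTopologicalGroup G] [CompactSpace G]
  [MeasurableSpace G] [BorelSpace G] {N : ℕ}

/-- Clause (i) is monotone in the mixing budget. -/
theorem clauseI_mono {ρ : G →* Matrix (Fin N) (Fin N) ℂ} {β : ℝ} {w : Fin 4 → ℤ → ℤ} {n : ℕ} {ε ε' : ℝ}
    (hε : ε ≤ ε') {Typ : (Fin 4 → ℤ) → Set (LGConfig 4 G)} (h : ClauseI ρ β w n ε Typ) :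
    ClauseI ρ β w n ε' Typ :=
  fun Y hY h0 σ σ' htyp hagree f hf hfm hf01 => (h Y hY h0 σ σ' htyp hagree f hf hfm hf01).trans hε

/-- Clause (i) at every centre is monotone in the mixing budget. -/
theorem clauseIAll_mono {ρ : G →* Matrix (Fin N) (Fin N) ℂ} {β : ℝ} {w : Fin 4 → ℤ → ℤ} {n : ℕ} {ε ε' : ℝ}
    (hε : ε ≤ ε') {Typ : (Fin 4 → ℤ) → Set (LGConfig 4 G)} (h : ClauseIAll ρ β w n ε Typ) :
    ClauseIAll ρ β w n ε' Typ :=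
  fun c₀ => clauseI_mono hε (h c₀)

/-- Clause (ii) (UKP rarity) is monotone in the rarity budget `δ ≥ 0`. -/
theorem clauseIIukp_mono {ρ : G →* Matrix (Fin N) (Fin N) ℂ} {β : ℝ} {w : Fin 4 → ℤ → ℤ} {δ δ' : ℝ}
    (hδ0 : 0 ≤ δ) (hδ : δ ≤ δ') {Typ : (Fin 4 → ℤ) → Set (LGConfig 4 G)} (h : ClauseIIukp ρ β w δ Typ) :
    ClauseIIukp ρ β w δ' Typ := by
  intro F F' hFF' hF ζ hcollar
  refine (h F F' hFF' hF ζ hcollar).trans (ENNReal.ofReal_le_ofReal ?_)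
  exact pow_le_pow_left₀ hδ0 hδ _

/-- Clause (iii) (torus anchor) is monotone in the rarity budget `δ ≥ 0`. -/
theorem clauseIII_mono {ρ : G →* Matrix (Fin N) (Fin N) ℂ} {β : ℝ} {w : Fin 4 → ℤ → ℤ} {b : ℕ} {δ δ' : ℝ}
    (hδ0 : 0 ≤ δ) (hδ : δ ≤ δ') {Typ : (Fin 4 → ℤ) → Set (LGConfig 4 G)} (h : ClauseIII ρ β w b δ Typ) :
    ClauseIII ρ β w b δ' Typ := by
  intro S hS F hF hin
  refine (h S hS F hF hin).trans (ENNReal.ofReal_le_ofReal ?_)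
  exact pow_le_pow_left₀ hδ0 hδ _

/-- **Format Uc is monotone in `(ε, δ)`**: a typical class certifying the format at budgets `(ε, δ)` certifies it at every
`(ε', δ')` with `ε ≤ ε'`, `0 ≤ δ ≤ δ'`. -/
theorem typShellCondUKPc_mono {ρ : G →* Matrix (Fin N) (Fin N) ℂ} {β : ℝ} {b n : ℕ} {ε ε' δ δ' : ℝ}
    (hε : ε ≤ ε') (hδ0 : 0 ≤ δ) (hδ : δ ≤ δ') (h : TypShellCondUKPc ρ β b n ε δ) :
    TypShellCondUKPc ρ β b n ε' δ' := by
  intro w hw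
  obtain ⟨Typ, hloc, hi, hii, hiii⟩ := h w hw
  exact ⟨Typ, hloc, clauseIAll_mono hε hi, clauseIIukp_mono hδ0 hδ hii, clauseIII_mono hδ0 hδ hiii⟩

/-- `shellCount n = (4n+3)⁴ − (4n+1)⁴ > 0`. -/
theorem shellCount_pos (n : ℕ) : 0 < OnsetFormats.shellCount n := by
  unfold OnsetFormats.shellCount
  have h : (4 * n + 1) ^ 4 < (4 * n + 3) ^ 4 := Nat.pow_lt_pow_left (by omega) (by norm_num)
  exact_mod_cast Nat.sub_pos_of_lt h

end Mono

/-! ## §2 The `SU(2)` fixed-mesh floor in Uc currency, uniform below the budget caps -/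
section Floor

/-- The rarity cap below which the `SU(2)` floor runs: `δ ≤ 1 / (8 (#windowCellsPlus n + 1))` gives `4 · #windowCellsPlus n · δ < 1`. -/
def deltaCap (n : ℕ) : ℝ := 1 / (8 * (((windowCellsPlus n).card : ℝ) + 1))

/-- The rarity cap is positive. -/
theorem deltaCap_pos (n : ℕ) : 0 < deltaCap n := by
  unfold deltaCap; positivity

/-- At the cap, the side condition `4 · #windowCellsPlus n · δ < 1` of the fixed-mesh floor holds. -/
theorem four_card_deltaCap_lt_one (n : ℕ) : 4 * ((windowCellsPlus n).card : ℝ) * deltaCap n < 1 := by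
  unfold deltaCap
  set k : ℝ := ((windowCellsPlus n).card : ℝ)
  have hk0 : 0 ≤ k := Nat.cast_nonneg _
  rw [show 4 * k * (1 / (8 * (k + 1))) = (4 * k) / (8 * (k + 1)) by ring, div_lt_one (by positivity)]
  linarith

/-- **The `SU(2)` floor in Uc currency, uniform below the caps (PROVED from `FixedMesh.typOnsetFloor_SU2` + §1).**  For the fundamental
representation of `SU(2)`, every `n` and every mesh bound `B`: for all large `β`, format Uc FAILS at every mesh `1 ≤ b ≤ B` and every budget
`0 ≤ ε ≤ 1/16`, `0 ≤ δ ≤ deltaCap n`. -/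
theorem floorSU2_uc [MeasurableSpace (Matrix.specialUnitaryGroup (Fin 2) ℂ)]
    [BorelSpace (Matrix.specialUnitaryGroup (Fin 2) ℂ)] (n B : ℕ) :
    ∃ β₁ : ℝ, ∀ β : ℝ, β₁ ≤ β → ∀ b : ℕ, 1 ≤ b → b ≤ B →
      ∀ ε δ : ℝ, 0 ≤ ε → ε ≤ 1 / 16 → 0 ≤ δ → δ ≤ deltaCap n →
        ¬ TypShellCondUKPc (fundamentalRep (Fin 2)) β b n ε δ := by
  obtain ⟨β₁, h⟩ := typOnsetFloor_SU2 n (ε := 1 / 16) (δ := deltaCap n) (by norm_num) (by norm_num)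
    (deltaCap_pos n).le (four_card_deltaCap_lt_one n) B
  refine ⟨β₁, fun β hβ b hb hbB ε δ hε0 hε hδ0 hδ hU => ?_⟩
  exact h β hβ b hb hbB (typShellCond_of_UKPc (typShellCondUKPc_mono hε hδ0 hδ hU))

end Floor

/-! ## §3 Diagonalisation: one unit map slower than countably many floors -/
section Diagonal

/-- **A slow unit map below countably many floors (PROVED; pure real analysis).**  If for every `n` and every mesh bound `B` the property
`Fail n β b` holds for all large `β` at every mesh `1 ≤ b ≤ B`, then ONE positive unit map `a → 0` makes, for every `n` and every `T`, every
mesh `b ≥ 1` with `a β · b < T` satisfy `Fail n β b` for all large `β`.  Construction: thresholds `t M ≥ M` dominating the floors of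
`n ≤ M` at mesh bound `(M+1)²`; `M(β)` = the largest `M ≤ ⌊β⌋₊` with `t M ≤ β`; `a β = 1/(M(β)+1)`. -/
theorem exists_slow_unit_map (Fail : ℕ → ℝ → ℕ → Prop)
    (H : ∀ n B : ℕ, ∃ β₁ : ℝ, ∀ β : ℝ, β₁ ≤ β → ∀ b : ℕ, 1 ≤ b → b ≤ B → Fail n β b) :
    ∃ a : ℝ → ℝ, (∀ β, 0 < a β) ∧ Tendsto a atTop (𝓝 0) ∧
      ∀ (n : ℕ) (T : ℝ), ∃ β₀ : ℝ, ∀ β : ℝ, β₀ ≤ β → ∀ b : ℕ, 1 ≤ b → a β * (b : ℝ) < T → Fail n β b := by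
  classical
  -- floors
  choose τ hτ using H
  -- thresholds: `t M ≥ M` and `t M ≥ τ n ((M+1)^2)` for `n ≤ M`
  let t : ℕ → ℝ := fun M => (M : ℝ) + ∑ n ∈ Finset.range (M + 1), |τ n ((M + 1) ^ 2)|
  have ht_ge : ∀ M : ℕ, (M : ℝ) ≤ t M := fun M =>
    le_add_of_nonneg_right (Finset.sum_nonneg fun _ _ => abs_nonneg _)
  have ht_floor : ∀ M n : ℕ, n ≤ M → τ n ((M + 1) ^ 2) ≤ t M := by
    intro M n hn
    have h1 : |τ n ((M + 1) ^ 2)| ≤ ∑ m ∈ Finset.range (M + 1), |τ m ((M + 1) ^ 2)| :=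
      Finset.single_le_sum (f := fun m => |τ m ((M + 1) ^ 2)|) (fun _ _ => abs_nonneg _)
        (Finset.mem_range.mpr (Nat.lt_succ_of_le hn))
    have h2 : (0 : ℝ) ≤ (M : ℝ) := Nat.cast_nonneg _
    calc τ n ((M + 1) ^ 2) ≤ |τ n ((M + 1) ^ 2)| := le_abs_self _
      _ ≤ t M := by simp only [t]; linarith
  -- the index function and the unit map
  let Mβ : ℝ → ℕ := fun β => Nat.findGreatest (fun M => t M ≤ β) ⌊β⌋₊
  let a : ℝ → ℝ := fun β => 1 / ((Mβ β : ℝ) + 1)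
  have ha : ∀ β, 0 < a β := fun β => by simp only [a]; positivity
  -- key: beyond `t K`, the index is at least `K`, and `t (Mβ β) ≤ β`
  have hM_ge : ∀ (K : ℕ) (β : ℝ), t K ≤ β → K ≤ Mβ β := by
    intro K β hK
    have hKβ : (K : ℝ) ≤ β := (ht_ge K).trans hK
    have hKfl : K ≤ ⌊β⌋₊ := Nat.le_floor hKβ
    exact Nat.le_findGreatest hKfl hK
  have hM_spec : ∀ (K : ℕ) (β : ℝ), t K ≤ β → t (Mβ β) ≤ β := by
    intro K β hK
    have hKβ : (K : ℝ) ≤ β := (ht_ge K).trans hK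
    exact Nat.findGreatest_spec (P := fun M => t M ≤ β) (Nat.le_floor hKβ) hK
  refine ⟨a, ha, ?_, ?_⟩
  · -- `a → 0`
    rw [Metric.tendsto_atTop]
    intro e he
    obtain ⟨K, hK⟩ := exists_nat_one_div_lt he
    refine ⟨t K, fun β hβ => ?_⟩
    have hKM : (K : ℝ) + 1 ≤ (Mβ β : ℝ) + 1 := by exact_mod_cast Nat.succ_le_succ (hM_ge K β hβ)
    have hpos : (0 : ℝ) < (K : ℝ) + 1 := by positivity
    rw [Real.dist_0_eq_abs, abs_of_pos (ha β)]
    calc a β = 1 / ((Mβ β : ℝ) + 1) := rfl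
      _ ≤ 1 / ((K : ℝ) + 1) := one_div_le_one_div_of_le hpos hKM
      _ < e := hK
  · -- every calibrated mesh is below the floor, eventually
    intro n T
    refine ⟨t (max n ⌈T⌉₊), fun β hβ b hb hlt => ?_⟩
    set M := Mβ β with hMdef
    have hMge : max n ⌈T⌉₊ ≤ M := hM_ge _ β hβ
    have hnM : n ≤ M := le_trans (le_max_left _ _) hMge
    have hTM : T ≤ (M : ℝ) := by
      have h1 : ⌈T⌉₊ ≤ M := le_trans (le_max_right _ _) hMge
      exact (Nat.ceil_le).mp h1
    have htM : t M ≤ β := hM_spec _ β hβ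
    -- `b < T (M+1) ≤ (M+1)^2`
    have hM1 : (0 : ℝ) < (M : ℝ) + 1 := by positivity
    have hb_lt : (b : ℝ) < T * ((M : ℝ) + 1) := by
      have : a β * (b : ℝ) = (b : ℝ) / ((M : ℝ) + 1) := by
        simp only [a, hMdef]; ring
      rw [this, div_lt_iff₀ hM1] at hlt
      exact hlt
    have hb_sq : b ≤ (M + 1) ^ 2 := by
      have h2 : (b : ℝ) < ((M : ℝ) + 1) * ((M : ℝ) + 1) :=
        hb_lt.trans_le (mul_le_mul_of_nonneg_right (by linarith) hM1.le)
      have h3 : (b : ℝ) < (((M + 1) ^ 2 : ℕ) : ℝ) := by push_cast; nlinarith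
      exact (by exact_mod_cast h3 : b < (M + 1) ^ 2).le
    exact hτ n ((M + 1) ^ 2) β ((ht_floor M n hnM).trans htM) b hb hb_sq

end Diagonal

/-! ## §4 `LowerBounds` is load-bearing for `stub_onsetSharpSC` -/
section WithoutLB

/-- **I♯_SC with the NT calibration DELETED**: `OnsetSharpUKPcSC` verbatim except that the hypothesis `LowerBounds G r a` is dropped —
«for every simply connected compact simple `G`, faithful unitary `r` and EVERY positive unit map `a → 0`, some admissible `(n, ε)` such that
for every rarity budget the format holds, for all large `β`, at some mesh `b ≥ 1` with `a β · b < T`». -/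
def OnsetSharpUKPcSCWithoutLB : Prop :=
  ∀ (G : Type) [Group G] [TopologicalSpace G] [IsTopologicalGroup G] [CompactSpace G],
    IsCompactSimpleLieGroup G → SimplyConnectedSpace G →
    letI : MeasurableSpace G := borel G; haveI : BorelSpace G := ⟨rfl⟩;
    ∀ (r : LatticeRep G) (a : ℝ → ℝ), (∀ β, 0 < a β) → Tendsto a atTop (𝓝 0) →
      ∃ (n : ℕ) (ε : ℝ), 1 ≤ n ∧ 0 ≤ ε ∧ ε * OnsetFormats.shellCount n ≤ 3 / 4 ∧
        ∀ δ : ℝ, 0 < δ → ∃ T β₂ : ℝ, ∀ β : ℝ, β₂ ≤ β →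
          ∃ b : ℕ, 1 ≤ b ∧ a β * (b : ℝ) < T ∧ TypShellCondUKPc r.ρ β b n ε δ

/-- The deleted form is the STRONGER statement (sanity: the mutation only drops a hypothesis). -/
theorem onsetSharpUKPcSC_of_withoutLB (h : OnsetSharpUKPcSCWithoutLB) : OnsetSharpUKPcSC := by
  intro G _ _ _ _ hG hsc
  letI : MeasurableSpace G := borel G
  haveI : BorelSpace G := ⟨rfl⟩
  intro r a ha hat _
  exact h G hG hsc r a ha hat

/-- **`LowerBounds` IS LOAD-BEARING (PROVED, unconditional): `stub_onsetSharpSC` with the NT calibration deleted is FALSE.**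
Witness: `SU(2)` (compact simple: `isCompactSimpleLieGroup_specialUnitaryGroup`; simply connected: the hypothesis `hSC`, discharged in
the tree by the sorry-free `Summit.QuantumFields.YangMills.Theorems.BrascampLiebVacuumSC.Negative.simplyConnectedSpace_su2` and carried
here only to keep this module outside the `ConvexGribovBody` theses cone), the fundamental representation, and the slow unit map of §3 over
the fixed-mesh floors of §2 — at every admissible `(n, ε)` (so `ε < 1/16`) and the budget `δ = deltaCap n`, for all large `β` format Uc fails
at EVERY mesh `b ≥ 1` with `a β · b < T`, whatever `T`.  Any proof of the registered stub must use `LowerBounds G r a` to bound the onset in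
units `a` from above. -/
theorem onsetSharpUKPcSC_false_without_lowerBounds
    (hSC : SimplyConnectedSpace (Matrix.specialUnitaryGroup (Fin 2) ℂ)) : ¬ OnsetSharpUKPcSCWithoutLB := by
  intro h
  letI : MeasurableSpace (Matrix.specialUnitaryGroup (Fin 2) ℂ) := borel _
  haveI : BorelSpace (Matrix.specialUnitaryGroup (Fin 2) ℂ) := ⟨rfl⟩
  -- the slow unit map below the `SU(2)` floors, uniformly over the capped budgets
  obtain ⟨a, ha, hat, hfail⟩ := exists_slow_unit_map
    (fun n β b => ∀ ε δ : ℝ, 0 ≤ ε → ε ≤ 1 / 16 → 0 ≤ δ → δ ≤ deltaCap n →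
      ¬ TypShellCondUKPc (fundamentalRep (Fin 2)) β b n ε δ)
    (fun n B => floorSU2_uc n B)
  obtain ⟨n, ε, -, hε0, hM, hδT⟩ := h (Matrix.specialUnitaryGroup (Fin 2) ℂ)
    (isCompactSimpleLieGroup_specialUnitaryGroup isSimpleCompactGroup_specialUnitaryGroup_holds le_rfl)
    hSC fundRepSU2 a ha hat
  have hε : ε ≤ 1 / 16 := by
    have h16 := sixteen_mul_eps_lt_one (shellCount_lt_one_of_le hM) hε0
    linarith
  obtain ⟨T, β₂, hb⟩ := hδT (deltaCap n) (deltaCap_pos n)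
  obtain ⟨β₀, hβ₀⟩ := hfail n T
  obtain ⟨b, hb1, hlt, hU⟩ := hb (max β₀ β₂) (le_max_right _ _)
  exact hβ₀ (max β₀ β₂) (le_max_left _ _) b hb1 hlt ε (deltaCap n) hε0 hε (deltaCap_pos n).le le_rfl hU

end WithoutLB

end Summit.QuantumFields.YangMills.Cruxes.IR.AfPincerUc.SharpOnset

end
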